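import Literature.Geometry.Lorentzian.KerrStabilitySubextremalCauchy
import Literature.Geometry.Lorentzian.KerrCollarConvergence
import HarnessLib

/-!
# Nonlinear stability of sub-extremal Kerr (Hintz 2026), Cauchy consequence form on the collar

`Literature.Geometry.Lorentzian.KerrStabilitySubextremalCauchy` records Hintz's full-sub-extremal
-range theorem (arXiv:2606.28253v2, Thm. 1.1 (p. 2), Thm. 13.1 (pp. 318–319), Remarks 13.2–13.3
(pp. 319–320); UNREFEREED CLAIM, `@[claim "Hintz2026" "under-review"]`, D-0012) in two one-sided
renderings: `hintz_kerr_stability_subextremal_cauchy` (`∃ (s, δ, k)`) and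
`hintz_kerr_stability_subextremal_cauchy_allOrders` (`∃ (s, δ)`, `∀ k` in the conclusion), both
concluding with a region `𝒟oc` and `Spacetime.ConvergesToKerr 𝒟oc M' a' k`, i.e. a late chart on
the ONE-SIDED exterior background `{r > r₊(M', a')}`, unoriented. This file adds the companion of
the all-orders rendering over the vocabulary of `KerrCollarConvergence` (item wi-34761, optional
companion of `klainerman_szeftel_kerr_stability_small_a_cauchy_collar`, `StabilityCauchyCollar`):
the conclusion chart lives on a TWO-SIDED collar `Kerr.region a' r₁`, `r₋(M', a') < r₁ < r₊(M', a')`,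
and is FUTURE-ORIENTED (`CauchyDevelopment.CollarConvergesToKerr`), for every order `k`. Both
clauses are printed:

* **collar.** (1.2) (p. 1): "`Ω := {r ≥ m₀, t̃ ≥ 0}`, with Cauchy hypersurface `Σ := t̃⁻¹(0)`",
  where `(t̃, x)` are the coordinates in which "the metric `g_b` extends analytically to the region
  `r > r⁻_b := m − √(m² − a²)`" (p. 1) and `m₀ ∈ (r⁻_{b₀}, r⁺_{b₀})` (as `|a₀| < m₀`), Figure 1.1
  ("The dashed line labeled `H⁺` is the event horizon for `g_b`", drawn inside `Ω`); Thm. 1.1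
  (p. 2): "the MGHD of `(Σ, γ, k)` contains a region isometric to `(Ω, g)`, where `g` is a
  Lorentzian metric satisfying `|g_{μν}(t̃, x) − (g_b)_{μν}(t̃, x)| ≲ (1 + t̃)^{−2−ε_K}` … for all `x`
  in a compact set; similarly for finite-order derivatives of `g − g_b` along `(1 + t̃)∂_t̃` and
  `∂ₓ`. Furthermore, `g` decays at quantitative rates in all asymptotic regions of `Ω`"; Thm. 13.1
  (p. 318): "`Ω := {t_IVP ≥ 0, r ≥ m₀}` of the subextremal Kerr spacetime manifold `(M°, g_{b₀})`",
  conclusion (p. 319): "`g` settles down to the Kerr metric `g_b` at the rates (1) `O(t_*^{−2−ε_K})`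
  in spatially compact subsets of `{r ≥ m₀}`, (2) …, (3) …, (4) `O(r⁻¹)` in the region `r/t_* ≥ C`";
  Remark 13.2 (p. 319): "the particular choice `r = m₀` of the interior spacelike boundary
  hypersurface of `Ω` is inconsequential; when working with `b₁ = (m₁, a₁)` instead of `b₀`, this
  choice is still acceptable as long as `m₀ ∈ (r⁻_{m₁,a₁}, r⁺_{m₁,a₁})` lies between the Cauchy and
  event horizon of `g_{b₁}`, which is true when `b₁` is close enough to `b₀`".
* **orientation.** `Ω ⊆ {t̃ ≥ 0}` is the future of the Cauchy hypersurface `Σ = t̃⁻¹(0)` ((1.2);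
  Thm. 13.1: the solution "attains the initial data `(φ_S)_*(γ, k)` at `φ_S(Σ_IVP)`", the past
  boundary of `φ_S(Ω)`).

Everything else is verbatim `hintz_kerr_stability_subextremal_cauchy_allOrders` — quantifier
shape `(χ₀, ρ₀) ↦ ∃ (s, δ, ς), ∀ (M, η), ∃ ε, ∀ a` with `|a/M − χ₀| < ς`, b-conormal data class,
smallness at one order, every MGHD, sub-extremal final parameters within `η`, far-origin
sojourn-complete `𝓘⁺`, `∀ k` — and its paraphrase notes (α)–(η) apply word for word, plus those of
`StabilityCauchyCollar` marked NEW there ((i) component bounds in ingoing Kerr–Schild Cartesian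
coordinates of the final `Kerr(M', a')`, under which `r` is `Kerr.radius a'` — Hintz's `(t̃, x)`
are such regular coordinates up to a Kerr-side diffeomorphism; (ii) `t̃`/`t_*`- versus `t*`-slabs;
(iii) `r₁` existential: in print the interior boundary is `{r = m₀}` = `{r = r₀}` for the tree's
leaf `Kerr.slice a r₀`, and only `r₋(M', a') < r₁ < r₊(M', a')` is recorded, Remark 13.2).

## Main results

* `hintz_kerr_stability_subextremal_cauchy_collar` — the claim (named fact shape, claim-tagged);
* `….pointwise` — per `(M, a, r₀)`: `∃ (s, δ), ∀ η, ∃ ε, …` (centre `χ₀ := a/M`, `ρ₀ := r₀/M`);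
* `….atUnitLeaf` — the leaf `r₀ = M` (`ρ₀ = 1`) with the spin ball kept (Remark 13.2), leaf
  hypotheses discharged by `Kerr.unitLeaf_admissible`;
* `….futureEventHorizon_subset` — the collar of the conclusion contains
  `Kerr.futureEventHorizon M' a'`;
* `….toExistsOrder` — the collar claim implies the one-sided `∃ k` claim
  `hintz_kerr_stability_subextremal_cauchy` (restriction of the collar chart to the exterior).

## Deliberately NOT transcribed

As in `KerrStabilitySubextremalCauchy` ((i) no modulus, (ii) no bare finite-order ball, (iii) no
uniformity as `|a₀| → m₀`, (iv) no polyhomogeneity / gauge / boost / `t_*⁻³`), and: no relation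
`r₁ ≤ r₀` (true in print, not needed by the consumers); no bridge to the `…_allOrders` rendering
(there ONE region `𝒟oc` serves every `k`; here each order has its own chart) — the bridge to the
`∃ k` rendering `hintz_kerr_stability_subextremal_cauchy` is `….toExistsOrder` (restriction of a
collar chart to the exterior, `CollarConvergesToKerr.exists_convergesToKerr_of_le`).

## References

* P. Hintz, *Nonlinear stability of subextremal Kerr black holes*, arXiv:2606.28253v2 [held:
  `paper:arxiv-2606.28253`, PDF page = printed page + 172 for Ch. 13; pp. 1–2 = PDF pp. 5–6]:
  (1.2) and Figure 1.1 (p. 1), Thm. 1.1 (p. 2), Thm. 13.1 (pp. 318–319), Remarks 13.2–13.3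
  (pp. 319–320). Bib key `Hintz2026`.
* S. Klainerman, J. Szeftel, PAMQ 19 (2023) = arXiv:2104.11857 (the slowly rotating precedent;
  `StabilityCauchyCollar`). Bib key `KlainermanSzeftel2023`.
* M. Dafermos, I. Rodnianski, arXiv:0811.0354, §5.1, Conj. 5.1. Bib key `DafermosRodnianski2008`.
-/

noncomputable section

open Set TopologicalSpace Filter
open scoped ContDiff ENNReal Manifold Topology

namespace Literature.Geometry.Lorentzian

/-- **Nonlinear stability of sub-extremal Kerr (Hintz 2026) — Cauchy consequence form ON THE
COLLAR, oriented, every order.** UNREFEREED CLAIM (named-fact shape, claim-tagged); the companion of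
`hintz_kerr_stability_subextremal_cauchy_allOrders` (`KerrStabilitySubextremalCauchy`) whose
conclusion chart lives on the two-sided region `Kerr.region a' r₁`, `r₋(M', a') < r₁ < r₊(M', a')`,
inside `J⁺(ι X)` (`CauchyDevelopment.CollarConvergesToKerr`, `KerrCollarConvergence`).

**Source, verbatim.** Hintz, arXiv:2606.28253v2. (1.2) (p. 1): "`Ω := {r ≥ m₀, t̃ ≥ 0}`, with
Cauchy hypersurface `Σ := t̃⁻¹(0)`", in coordinates `(t̃, x)` in which "the metric `g_b` extends
analytically to the region `r > r⁻_b`". Thm. 1.1 (p. 2): "Let `b₀ = (m₀, a₀)` be subextremal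
parameters. Suppose that the initial data `γ, k ∈ C^∞(Σ; S²T*Σ)` satisfy the constraint equations
(1.3). Suppose moreover that `(γ, k) = (γ_{b₀}, k_{b₀})` outside of a compact set, and that
`γ − γ_{b₀}` and `k − k_{b₀}` are small in the Sobolev space `H^d(Σ)` for some large `d`. Then there
exist subextremal parameters `b = (m, a)` close to `b₀` such that the MGHD of `(Σ, γ, k)` contains
a region isometric to `(Ω, g)`, where `g` is a Lorentzian metric satisfying
`|g_{μν}(t̃, x) − (g_b)_{μν}(t̃, x)| ≲ (1 + t̃)^{−2−ε_K}` for some `ε_K > 0` and for all `x` in a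
compact set; similarly for finite-order derivatives of `g − g_b` along `(1 + t̃)∂_t̃` and `∂ₓ`.
Furthermore, `g` decays at quantitative rates in all asymptotic regions of `Ω`, namely
`r⁻¹(r/t̃)^{2+ε_K}` for `r/t̃ ≤ 1/4`, further `r⁻¹` for `r/t̃ ≥ 3/4` (including near null
infinity), and finally `t̃⁻¹ log t̃` for `r/t̃ ∈ [1/4, 3/4]`." Thm. 13.1 (pp. 318–319): on
"`Ω := {t_IVP ≥ 0, r ≥ m₀}`", data with (13.1a) `γ − γ_{b₀} ∈ H_b^{∞,(E₀,3+ε₀)}(Σ_IVP)`,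
`k − k_{b₀} ∈ H_b^{∞,(E₀+1,4+ε₀)}(Σ_IVP)` and (13.1b) smallness in `H_b^d` ("there exist `ε > 0`,
`d ∈ ℕ₀` … such that the following holds"); conclusion (13.2)–(13.3) and "`g` settles down to the
Kerr metric `g_b` at the rates (1) `O(t_*^{−2−ε_K})` in spatially compact subsets of `{r ≥ m₀}`, …
(4) `O(r⁻¹)` in the region `r/t_* ≥ C`". Remark 13.2 (p. 319): validity with `b₀` replaced by
`b₁`, `|b₁ − b₀| < ε`, and "the particular choice `r = m₀` of the interior spacelike boundary
hypersurface of `Ω` is inconsequential … acceptable as long as `m₀ ∈ (r⁻_{m₁,a₁}, r⁺_{m₁,a₁})` lies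
between the Cauchy and event horizon of `g_{b₁}`". Remark 13.3 (pp. 319–320): the choice of Cauchy
hypersurface is of little consequence.

**Statement (tree vocabulary).** For every normalised sub-extremal centre `χ₀ ∈ (−1, 1)` and every
normalised inner radius `ρ₀ ∈ (1 − √(1 − χ₀²), 1 + √(1 − χ₀²))` there are `(s, δ)` and a spin
radius `ς > 0`; and for every mass `M > 0` and tolerance `η > 0` ONE basin radius `ε > 0` serving
every spin `a` with `|a/M − χ₀| < ς` at the inner radius `r₀ = ρ₀ M ∈ (r₋(M,a), r₊(M,a))`: every
solution `D` of the vacuum constraints on `Kerr.slice a r₀`, b-conormal relative to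
`Kerr.data M a r₀` at weight `δ` (finite distance at EVERY order `s'`, (13.1a) at `E₀ = ∅`) and
`ε`-close at the one order `s` ((13.1b)), has all its maximal vacuum Cauchy developments `𝒟` with:
SUB-EXTREMAL `(M', a')` with `|M' − M| + |a' − a| ≤ η`, an inner radius
`r₋(M', a') < r₁ < r₊(M', a')`, sojourn-complete far `𝓘⁺`, and, for every `k : ℕ`, oriented
two-sided `Cᵏ` convergence to `g_{M',a'}` on the collar `{r > r₁}`
(`CollarConvergesToKerr 𝒟 M' a' r₁ k`).

**Paraphrase notes.** (α)–(η) of `hintz_kerr_stability_subextremal_cauchy` and the all-orders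
reading of `…_allOrders` apply verbatim; in addition (module docstring): component bounds in
regular coordinates of the final `Kerr(M', a')` across its event horizon (Hintz's `(t̃, x)`, up to
a Kerr-side diffeomorphism onto ingoing Kerr–Schild Cartesian coordinates, `r = Kerr.radius a'`);
`t̃`/`t_*`-decay read on `t*`-slabs; `r₁` existential (in print the interior boundary `{r = m₀}`,
any radius between the final horizons being admissible, Remark 13.2); orientation from
`Ω ⊆ {t̃ ≥ 0} = J⁺(Σ) ∩ …`. Unrefereed (v2, 2026-08-03). [cite: Hintz2026, (1.2) and Thm. 1.1 (pp. 1–2); Thm. 13.1 (pp. 318–319); Remark 13.2 (p. 319)] -/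
@[claim "Hintz2026" "under-review"]
def hintz_kerr_stability_subextremal_cauchy_collar [Kerr.Facts] [Kerr.SliceFacts] : Prop :=
  ∀ χ₀ : ℝ, |χ₀| < 1 → ∀ ρ₀ ∈ Set.Ioo (1 - √(1 - χ₀ ^ 2)) (1 + √(1 - χ₀ ^ 2)),
    ∃ (s : ℕ) (δ : ℝ), ∃ ς > (0 : ℝ), ∀ (M : ℝ) (hM : 0 < M), ∀ η > (0 : ℝ), ∃ ε > (0 : ℝ),
      ∀ a r₀ : ℝ, |a / M - χ₀| < ς → r₀ = ρ₀ * M →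
        r₀ ∈ Set.Ioo (Kerr.rMinus M a) (Kerr.rPlus M a) →
        ∀ (D : InitialDataSet 𝓘(ℝ, E3) (Kerr.slice a r₀)) [D.metric.HasLeviCivita],
          D.IsVacuumConstraintSolution →
          (∀ s' : ℕ,
            InitialDataSet.dataWeightedSobolevEDist s' δ D (Kerr.data M a r₀ hM.le) < ⊤) →
          InitialDataSet.dataWeightedSobolevEDist s δ D (Kerr.data M a r₀ hM.le) <
            ENNReal.ofReal ε →
          ∀ 𝒟 : VacuumCauchyDevelopment D, 𝒟.IsMaximal →
            ∃ (M' a' r₁ : ℝ), Kerr.IsSubextremal M' a' ∧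
              Kerr.rMinus M' a' < r₁ ∧ r₁ < Kerr.rPlus M' a' ∧
              |M' - M| + |a' - a| ≤ η ∧
              𝒟.HasCompleteFutureNullInfinityFar ∧
              ∀ k : ℕ, CauchyDevelopment.CollarConvergesToKerr 𝒟.toCauchyDevelopment M' a' r₁ k

/-- **Pointwise form.** From `hintz_kerr_stability_subextremal_cauchy_collar`, for each `0 < M`,
`|a| < M` and each inner radius `r₀ ∈ (r₋, r₊)` separately: there are `(s, δ)` such that for every
tolerance `η > 0` some `ε > 0` serves all b-conormal, `ε`-close vacuum data on `Kerr.slice a r₀`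
(centre `χ₀ := a/M`, `ρ₀ := r₀/M`; the proof is that of
`hintz_kerr_stability_subextremal_cauchy.pointwise`). Hintz, arXiv:2606.28253, Thm. 13.1.
[cite: Hintz2026, Thm. 13.1 (pp. 318–319)] -/
theorem hintz_kerr_stability_subextremal_cauchy_collar.pointwise [Kerr.Facts] [Kerr.SliceFacts]
    (h : hintz_kerr_stability_subextremal_cauchy_collar) (M a : ℝ) (hM : 0 < M)
    (ha : Kerr.IsSubextremal M a) {r₀ : ℝ}
    (hr₀ : r₀ ∈ Set.Ioo (Kerr.rMinus M a) (Kerr.rPlus M a)) :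
    ∃ (s : ℕ) (δ : ℝ), ∀ η > (0 : ℝ), ∃ ε > (0 : ℝ),
      ∀ (D : InitialDataSet 𝓘(ℝ, E3) (Kerr.slice a r₀)) [D.metric.HasLeviCivita],
        D.IsVacuumConstraintSolution →
        (∀ s' : ℕ,
          InitialDataSet.dataWeightedSobolevEDist s' δ D (Kerr.data M a r₀ hM.le) < ⊤) →
        InitialDataSet.dataWeightedSobolevEDist s δ D (Kerr.data M a r₀ hM.le) <
          ENNReal.ofReal ε →
        ∀ 𝒟 : VacuumCauchyDevelopment D, 𝒟.IsMaximal →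
          ∃ (M' a' r₁ : ℝ), Kerr.IsSubextremal M' a' ∧
            Kerr.rMinus M' a' < r₁ ∧ r₁ < Kerr.rPlus M' a' ∧
            |M' - M| + |a' - a| ≤ η ∧
            𝒟.HasCompleteFutureNullInfinityFar ∧
            ∀ k : ℕ, CauchyDevelopment.CollarConvergesToKerr 𝒟.toCauchyDevelopment M' a' r₁ k := by
  have hχ₀ : |a / M| < 1 := by
    rw [abs_div, abs_of_pos hM, div_lt_one hM]
    exact ha
  obtain ⟨hminus, hplus⟩ := Kerr.rPlus_rMinus_eq_mul_normalised hM a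
  have hρ₀ : r₀ / M ∈ Set.Ioo (1 - √(1 - (a / M) ^ 2)) (1 + √(1 - (a / M) ^ 2)) := by
    rw [Set.mem_Ioo, lt_div_iff₀ hM, div_lt_iff₀ hM]
    constructor
    · have := hr₀.1; rw [hminus] at this; linarith
    · have := hr₀.2; rw [hplus] at this; linarith
  obtain ⟨s, δ, ς, hς, H⟩ := h (a / M) hχ₀ (r₀ / M) hρ₀
  refine ⟨s, δ, fun η hη ↦ ?_⟩
  obtain ⟨ε, hε, Hε⟩ := H M hM η hη
  refine ⟨ε, hε, fun D _ hvac hcon hdist 𝒟 hmax ↦ ?_⟩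
  exact Hε a r₀ (by simpa using hς) (by field_simp) hr₀ D hvac hcon hdist 𝒟 hmax

/-- **Capture germ at a centre, unit leaf, collar form.** Around every normalised sub-extremal
centre `χ₀ ∈ (−1, 1)` there are `(s, δ)` and a spin radius `ς > 0`, and per mass `M > 0` and
tolerance `η > 0` ONE basin `ε > 0`, serving every SUB-EXTREMAL spin `a` with `|a/M − χ₀| < ς` at the
leaf `r₀ = M` (`ρ₀ = 1`, leaf hypotheses discharged by `Kerr.unitLeaf_admissible`): b-conormal,
`ε`-close vacuum data on `Kerr.slice a M` have all maximal vacuum Cauchy developments with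
sub-extremal final parameters within `η`, a collar radius between the final horizons,
sojourn-complete far `𝓘⁺`, and oriented collar convergence to `g_{M',a'}` in `Cᵏ` for every `k`.
Hintz, arXiv:2606.28253v2, Thm. 13.1 and Remark 13.2 (local uniformity in the centre at the fixed
interior boundary `r = m₀`). [cite: Hintz2026, Thm. 13.1 (pp. 318–319) and Remark 13.2 (p. 319)] -/
theorem hintz_kerr_stability_subextremal_cauchy_collar.atUnitLeaf [Kerr.Facts] [Kerr.SliceFacts]
    (h : hintz_kerr_stability_subextremal_cauchy_collar) (χ₀ : ℝ) (hχ₀ : |χ₀| < 1) :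
    ∃ (s : ℕ) (δ : ℝ), ∃ ς > (0 : ℝ), ∀ (M : ℝ) (hM : 0 < M), ∀ η > (0 : ℝ), ∃ ε > (0 : ℝ),
      ∀ a : ℝ, |a / M - χ₀| < ς → Kerr.IsSubextremal M a →
        ∀ (D : InitialDataSet 𝓘(ℝ, E3) (Kerr.slice a M)) [D.metric.HasLeviCivita],
          D.IsVacuumConstraintSolution →
          (∀ s' : ℕ,
            InitialDataSet.dataWeightedSobolevEDist s' δ D (Kerr.data M a M hM.le) < ⊤) →
          InitialDataSet.dataWeightedSobolevEDist s δ D (Kerr.data M a M hM.le) <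
            ENNReal.ofReal ε →
          ∀ 𝒟 : VacuumCauchyDevelopment D, 𝒟.IsMaximal →
            ∃ (M' a' r₁ : ℝ), Kerr.IsSubextremal M' a' ∧
              Kerr.rMinus M' a' < r₁ ∧ r₁ < Kerr.rPlus M' a' ∧
              |M' - M| + |a' - a| ≤ η ∧
              𝒟.HasCompleteFutureNullInfinityFar ∧
              ∀ k : ℕ,
                CauchyDevelopment.CollarConvergesToKerr 𝒟.toCauchyDevelopment M' a' r₁ k := by
  obtain ⟨s, δ, ς, hς, H⟩ := h χ₀ hχ₀ 1 (Kerr.unitLeaf_admissible.1 χ₀ hχ₀)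
  refine ⟨s, δ, ς, hς, fun M hM η hη ↦ ?_⟩
  obtain ⟨ε, hε, Hε⟩ := H M hM η hη
  refine ⟨ε, hε, fun a ha hsub D _ hvac hcon hdist 𝒟 hmax ↦ ?_⟩
  exact Hε a M ha (by ring) (Kerr.unitLeaf_admissible.2 M a hM hsub) D hvac hcon hdist 𝒟 hmax

/-- **The collar contains the final event horizon**: under the claim, per `(M, a, r₀)`, the
reference horizon `Kerr.futureEventHorizon M' a' = {r = r₊(M', a')}` of the final Kerr solution lies
in the chart region of the conclusion, which converges in `Cᵏ` for every `k`
(`Kerr.futureEventHorizon_subset_collarBackground_domain`; Hintz, Figure 1.1: "The dashed line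
labeled `H⁺` is the event horizon for `g_b`", inside `Ω`). [cite: Hintz2026, (1.2) and Figure 1.1 (p. 1)] -/
theorem hintz_kerr_stability_subextremal_cauchy_collar.futureEventHorizon_subset [Kerr.Facts]
    [Kerr.SliceFacts] (h : hintz_kerr_stability_subextremal_cauchy_collar) (M a : ℝ) (hM : 0 < M)
    (ha : Kerr.IsSubextremal M a) {r₀ : ℝ}
    (hr₀ : r₀ ∈ Set.Ioo (Kerr.rMinus M a) (Kerr.rPlus M a)) :
    ∃ (s : ℕ) (δ : ℝ), ∀ η > (0 : ℝ), ∃ ε > (0 : ℝ),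
      ∀ (D : InitialDataSet 𝓘(ℝ, E3) (Kerr.slice a r₀)) [D.metric.HasLeviCivita],
        D.IsVacuumConstraintSolution →
        (∀ s' : ℕ,
          InitialDataSet.dataWeightedSobolevEDist s' δ D (Kerr.data M a r₀ hM.le) < ⊤) →
        InitialDataSet.dataWeightedSobolevEDist s δ D (Kerr.data M a r₀ hM.le) <
          ENNReal.ofReal ε →
        ∀ 𝒟 : VacuumCauchyDevelopment D, 𝒟.IsMaximal →
          ∃ (M' a' r₁ : ℝ), Kerr.IsSubextremal M' a' ∧
            Kerr.futureEventHorizon M' a' ⊆ ((Kerr.collarBackground M' a' r₁).domain : Set E4) ∧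
            |M' - M| + |a' - a| ≤ η ∧
            ∀ k : ℕ, CauchyDevelopment.CollarConvergesToKerr 𝒟.toCauchyDevelopment M' a' r₁ k := by
  obtain ⟨s, δ, H⟩ := h.pointwise M a hM ha hr₀
  refine ⟨s, δ, fun η hη ↦ ?_⟩
  obtain ⟨ε, hε, Hε⟩ := H η hη
  refine ⟨ε, hε, fun D _ hvac hcon hdist 𝒟 hmax ↦ ?_⟩
  obtain ⟨M', a', r₁, hsub, -, hrp, hpar, -, hcol⟩ := Hε D hvac hcon hdist 𝒟 hmax
  exact ⟨M', a', r₁, hsub, Kerr.futureEventHorizon_subset_collarBackground_domain hsub hrp, hpar,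
    hcol⟩

/-- **The collar claim implies the one-sided `∃ k` claim** `hintz_kerr_stability_subextremal_cauchy`
(`KerrStabilitySubextremalCauchy`): restrict the order-`2` collar chart along
`Kerr.exterior M' a' ≤ Kerr.region a' r₁` (`r₁ < r₊(M', a')`;
`CollarConvergesToKerr.exists_convergesToKerr_of_le`) and forget the orientation. Hintz,
arXiv:2606.28253, Thm. 13.1. [cite: Hintz2026, Thm. 13.1 (pp. 318–319)] -/
theorem hintz_kerr_stability_subextremal_cauchy_collar.toExistsOrder [Kerr.Facts]
    [Kerr.SliceFacts] (h : hintz_kerr_stability_subextremal_cauchy_collar) :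
    hintz_kerr_stability_subextremal_cauchy := by
  intro χ₀ hχ₀ ρ₀ hρ₀
  obtain ⟨s, δ, ς, hς, H⟩ := h χ₀ hχ₀ ρ₀ hρ₀
  refine ⟨s, δ, 2, ς, hς, fun M hM η hη ↦ ?_⟩
  obtain ⟨ε, hε, Hε⟩ := H M hM η hη
  refine ⟨ε, hε, fun a r₀ ha hr₀ hr D _ hvac hcon hdist 𝒟 hmax ↦ ?_⟩
  obtain ⟨M', a', r₁, hsub, -, hrp, hpar, hfar, hcol⟩ :=
    Hε a r₀ ha hr₀ hr D hvac hcon hdist 𝒟 hmax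
  obtain ⟨𝒟oc, -, hconv⟩ := (hcol 2).exists_convergesToKerr_of_le hrp.le
  exact ⟨M', a', 𝒟oc, hsub, hpar, hfar, hconv⟩

end Literature.Geometry.Lorentzian

end
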